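import Literature.Analysis.Calculus.DividedDerivatives
import Mathlib.NumberTheory.Padics.PadicVal.Basic
import Mathlib.Data.Nat.Prime.Factorial
import HarnessLib

/-!
# `p`-adic orders of Taylor coefficients of rational functions over `ℚ`

Topic `Literature/NumberTheory/Transcendental`. Book-keeping for the `p`-adic half of the
arithmetic method ([Zudilin2004, §7, Lemmas 17–18; §8, Lemma 19]):

* `PadicOrdGe p v q` — "`ord_p q ≥ v`" for a rational `q` (vacuous for `q = 0`), with its
  behaviour under sums, products, powers, reciprocals, and the criterion
  `Rat.exists_int_of_padicOrdGe` ("`ord_p q ≥ 0` for every prime `p`" implies `q ∈ ℤ`);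
* `IsDOrd p e N f x` — `f` is `C^N` at `x` and `ord_p f^{(j)}(x) ≥ e - j` for all `j ≤ N`, the
  shape of [Zudilin2004, Lemmas 17, 18] ("`ord_p R^{(j)}(-k) ≥ -j + ⌊…⌋ - ⌊…⌋ - ⌊…⌋`"); closed
  under sums (same `e`) and products (the `e`'s add, Leibniz rule), local, and for `p > N` it
  bounds the divided derivatives `(1/j!) f^{(j)}(x)` as well (`IsDOrd.padicOrdGe_divDeriv`).

Everything here is PROVED (no named facts).

## References

* [Zudilin2004] W. Zudilin, *Arithmetic of linear forms involving odd zeta values*, J. Théor.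
  Nombres Bordeaux 16 (2004), 251–291, §7 (Lemmas 17–18), §8 (Lemma 19).
-/

noncomputable section

open Finset Filter Literature.Analysis.Calculus
open scoped Nat

namespace Literature.NumberTheory.Transcendental

/-! ### `ord_p q ≥ v` for rationals -/

/-- `PadicOrdGe p v q`: the `p`-adic order of the rational number `q` is at least `v`
(vacuously true for `q = 0`). [folklore] -/
def PadicOrdGe (p : ℕ) (v : ℤ) (q : ℚ) : Prop :=
  q = 0 ∨ v ≤ padicValRat p q

namespace PadicOrdGe

variable {p : ℕ}

/-- [folklore] -/
theorem zero (v : ℤ) : PadicOrdGe p v 0 := Or.inl rfl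

/-- [folklore] -/
theorem mono {v w : ℤ} {q : ℚ} (h : PadicOrdGe p w q) (hvw : v ≤ w) : PadicOrdGe p v q :=
  h.imp id fun h' => hvw.trans h'

/-- Integers have non-negative order. [folklore] -/
theorem of_int (z : ℤ) : PadicOrdGe p 0 (z : ℚ) :=
  Or.inr (by rw [padicValRat.of_int]; exact_mod_cast Nat.zero_le _)

/-- Naturals have non-negative order. [folklore] -/
theorem of_nat (n : ℕ) : PadicOrdGe p 0 (n : ℚ) := by
  have := of_int (p := p) (n : ℤ)
  simpa using this

/-- Additivity: `ord_p(q + r) ≥ min`. [folklore] -/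
theorem add [Fact p.Prime] {v : ℤ} {q r : ℚ} (hq : PadicOrdGe p v q) (hr : PadicOrdGe p v r) :
    PadicOrdGe p v (q + r) := by
  rcases hq with rfl | hq
  · rw [zero_add]; exact hr
  rcases hr with rfl | hr
  · rw [add_zero]; exact Or.inr hq
  by_cases hqr : q + r = 0
  · exact Or.inl hqr
  · exact Or.inr ((le_min hq hr).trans (padicValRat.min_le_padicValRat_add hqr))

/-- Finite sums. [folklore] -/
theorem sum [Fact p.Prime] {ι : Type*} {v : ℤ} {s : Finset ι} {f : ι → ℚ} (h : ∀ i ∈ s, PadicOrdGe p v (f i)) :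
    PadicOrdGe p v (∑ i ∈ s, f i) := by
  classical
  induction s using Finset.induction_on with
  | empty => simpa using zero v
  | insert a s ha ih =>
    rw [sum_insert ha]
    exact (h a (mem_insert_self a s)).add (ih fun i hi => h i (mem_insert_of_mem hi))

/-- Multiplicativity: `ord_p(qr) = ord_p q + ord_p r`. [folklore] -/
theorem mul [Fact p.Prime] {v w : ℤ} {q r : ℚ} (hq : PadicOrdGe p v q) (hr : PadicOrdGe p w r) :
    PadicOrdGe p (v + w) (q * r) := by
  rcases hq with rfl | hq
  · simpa using zero (v + w)
  rcases hr with rfl | hr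
  · simpa using zero (v + w)
  by_cases hq0 : q = 0
  · exact Or.inl (by simp [hq0])
  by_cases hr0 : r = 0
  · exact Or.inl (by simp [hr0])
  exact Or.inr (by rw [padicValRat.mul hq0 hr0]; exact add_le_add hq hr)

/-- Finite products. [folklore] -/
theorem prod [Fact p.Prime] {ι : Type*} {s : Finset ι} {v : ι → ℤ} {f : ι → ℚ}
    (h : ∀ i ∈ s, PadicOrdGe p (v i) (f i)) : PadicOrdGe p (∑ i ∈ s, v i) (∏ i ∈ s, f i) := by
  classical
  induction s using Finset.induction_on with
  | empty => simpa using of_int (p := p) 1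
  | insert a s ha ih =>
    rw [sum_insert ha, prod_insert ha]
    exact (h a (mem_insert_self a s)).mul (ih fun i hi => h i (mem_insert_of_mem hi))

/-- Powers. [folklore] -/
theorem pow [Fact p.Prime] {v : ℤ} {q : ℚ} (h : PadicOrdGe p v q) (n : ℕ) :
    PadicOrdGe p (n * v) (q ^ n) := by
  induction n with
  | zero => simpa using of_int (p := p) 1
  | succ n ih =>
    have := ih.mul h
    rw [pow_succ]
    convert this using 1
    push_cast
    ring

/-- The order of a non-zero rational, as a `PadicOrdGe` statement. [folklore] -/
theorem of_eq {q : ℚ} {v : ℤ} (h : v ≤ padicValRat p q) : PadicOrdGe p v q := Or.inr h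

/-- Reciprocal of an integer `c` with `ord_p c ≤ m`: `ord_p (1/c) ≥ -m`. [folklore] -/
theorem inv_of_int [Fact p.Prime] {c : ℤ} {m : ℕ} (h : padicValInt p c ≤ m) :
    PadicOrdGe p (-(m : ℤ)) ((c : ℚ)⁻¹) := by
  refine Or.inr ?_
  rw [padicValRat.inv, padicValRat.of_int, neg_le_neg_iff]
  exact_mod_cast h

end PadicOrdGe

/-- **A rational number all of whose `p`-adic orders are non-negative is an integer.**
[folklore] -/
theorem Rat.exists_int_of_padicOrdGe {q : ℚ}
    (h : ∀ p : ℕ, p.Prime → PadicOrdGe p 0 q) : ∃ z : ℤ, q = z := by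
  by_cases hq : q = 0
  · exact ⟨0, by simp [hq]⟩
  by_contra hne
  have hden : q.den ≠ 1 := by
    intro h1
    exact hne ⟨q.num, (Rat.den_eq_one_iff q |>.1 h1).symm⟩
  set p := q.den.minFac with hpdef
  have hp : p.Prime := Nat.minFac_prime hden
  haveI : Fact p.Prime := ⟨hp⟩
  have hpd : p ∣ q.den := Nat.minFac_dvd _
  have hnum : ¬ (p : ℤ) ∣ q.num := by
    intro hdiv
    have hcop := q.reduced
    have : p ∣ Int.natAbs q.num := Int.natCast_dvd.1 (Int.dvd_natAbs.2 hdiv) |> fun h => by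
      exact_mod_cast h
    have := Nat.dvd_gcd this hpd
    rw [hcop] at this
    exact hp.one_lt.ne' (Nat.dvd_one.1 this)
  have hval : padicValRat p q < 0 := by
    rw [padicValRat_def, padicValInt.eq_zero_of_not_dvd hnum]
    have : 1 ≤ padicValNat p q.den := one_le_padicValNat_of_dvd q.den_nz hpd
    omega
  rcases h p hp with h0 | h0
  · exact hq h0
  · exact absurd (h0.trans_lt hval) (lt_irrefl _)

/-! ### `ord_p f^{(j)}(x) ≥ e - j` for `j ≤ N` -/

/-- `IsDOrd p e N f x`: `f` is `C^N` at `x` and `ord_p f^{(j)}(x) ≥ -j + e` for every `j ≤ N`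
(the shape of [Zudilin2004, Lemmas 17–18]). [cite: Zudilin2004, §7 Lemmas 17–18] -/
structure IsDOrd (p : ℕ) (e : ℤ) (N : ℕ) (f : ℚ → ℚ) (x : ℚ) : Prop where
  contDiffAt : ContDiffAt ℚ N f x
  ord : ∀ j ≤ N, PadicOrdGe p (e - j) (iteratedDeriv j f x)

namespace IsDOrd

variable {p : ℕ} {e e' : ℤ} {N : ℕ} {f g : ℚ → ℚ} {x : ℚ}

/-- Lower the order. [folklore] -/
theorem of_le (h : IsDOrd p e N f x) {M : ℕ} (hM : M ≤ N) : IsDOrd p e M f x :=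
  ⟨h.contDiffAt.of_le (by exact_mod_cast hM), fun j hj => h.ord j (hj.trans hM)⟩

/-- Weaken the exponent. [folklore] -/
theorem mono (h : IsDOrd p e N f x) (he : e' ≤ e) : IsDOrd p e' N f x :=
  ⟨h.contDiffAt, fun j hj => (h.ord j hj).mono (by omega)⟩

/-- **Closure under products** (Leibniz rule): the exponents add. [folklore] -/
theorem mul [Fact p.Prime] (hf : IsDOrd p e N f x) (hg : IsDOrd p e' N g x) :
    IsDOrd p (e + e') N (fun t => f t * g t) x := by
  refine ⟨hf.contDiffAt.mul hg.contDiffAt, fun j hj => ?_⟩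
  have hfj : ContDiffAt ℚ j f x := hf.contDiffAt.of_le (by exact_mod_cast hj)
  have hgj : ContDiffAt ℚ j g x := hg.contDiffAt.of_le (by exact_mod_cast hj)
  rw [iteratedDeriv_fun_mul hfj hgj]
  refine PadicOrdGe.sum fun i hi => ?_
  have hij : i ≤ j := Nat.lt_succ_iff.1 (mem_range.1 hi)
  have h1 : PadicOrdGe p 0 ((j.choose i : ℕ) : ℚ) := PadicOrdGe.of_nat _
  have h2 := hf.ord i (hij.trans hj)
  have h3 := hg.ord (j - i) ((Nat.sub_le j i).trans hj)
  have := (h1.mul h2).mul h3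
  refine this.mono (le_of_eq ?_)
  push_cast [Nat.cast_sub hij]
  ring

/-- A function all of whose derivatives up to order `N` at `x` are integers (e.g. an integer
polynomial at an integer point) has `IsDOrd p 0`. [folklore] -/
theorem of_int_derivs (hc : ContDiffAt ℚ N f x) (h : ∀ j ≤ N, ∃ z : ℤ, iteratedDeriv j f x = z) :
    IsDOrd p 0 N f x := by
  refine ⟨hc, fun j hj => ?_⟩
  obtain ⟨z, hz⟩ := h j hj
  rw [hz]
  exact (PadicOrdGe.of_int z).mono (by omega)

/-- The constant function `1`. [folklore] -/
theorem one (N : ℕ) (x : ℚ) : IsDOrd p 0 N (fun _ => (1 : ℚ)) x := by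
  refine of_int_derivs contDiffAt_const fun j _ => ?_
  rcases Nat.eq_zero_or_pos j with rfl | hj
  · exact ⟨1, by simp⟩
  · exact ⟨0, by simp [iteratedDeriv_const, hj.ne']⟩

/-- Finite products: the exponents add up. [folklore] -/
theorem prod [Fact p.Prime] {ι : Type*} (s : Finset ι) {E : ι → ℤ} {F : ι → ℚ → ℚ}
    (h : ∀ i ∈ s, IsDOrd p (E i) N (F i) x) :
    IsDOrd p (∑ i ∈ s, E i) N (fun t => ∏ i ∈ s, F i t) x := by
  classical
  induction s using Finset.induction_on with
  | empty => simpa using one (p := p) N x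
  | insert a s ha ih =>
    have := (h a (mem_insert_self a s)).mul (ih fun i hi => h i (mem_insert_of_mem hi))
    simpa [prod_insert ha, sum_insert ha] using this

/-- Powers. [folklore] -/
theorem pow [Fact p.Prime] (h : IsDOrd p e N f x) (n : ℕ) :
    IsDOrd p (n * e) N (fun t => f t ^ n) x := by
  induction n with
  | zero => simpa using one (p := p) N x
  | succ n ih =>
    have := ih.mul h
    simp only [pow_succ]
    convert this using 2
    push_cast
    ring

/-- Consequence for divided derivatives when `p > N`: `ord_p (1/j!) f^{(j)}(x) ≥ e - j` as well
(`p ∤ j!` for `j ≤ N < p`). [folklore] -/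
theorem padicOrdGe_divDeriv [hp : Fact p.Prime] (h : IsDOrd p e N f x) (hpN : N < p) {j : ℕ}
    (hj : j ≤ N) : PadicOrdGe p (e - j) (divDeriv j f x) := by
  rw [divDeriv, div_eq_mul_inv]
  have hfact : PadicOrdGe p 0 ((j ! : ℚ))⁻¹ := by
    refine Or.inr ?_
    rw [padicValRat.inv, padicValRat.of_nat]
    have : padicValNat p (j !) = 0 := by
      refine padicValNat.eq_zero_of_not_dvd fun hdiv => ?_
      have := (Nat.Prime.dvd_factorial hp.out).1 hdiv
      omega
    simp [this]
  simpa using (h.ord j hj).mul hfact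

/-- Closure under sums (same exponent). [folklore] -/
theorem add [Fact p.Prime] (hf : IsDOrd p e N f x) (hg : IsDOrd p e N g x) :
    IsDOrd p e N (fun t => f t + g t) x := by
  refine ⟨hf.contDiffAt.add hg.contDiffAt, fun j hj => ?_⟩
  have hfj : ContDiffAt ℚ j f x := hf.contDiffAt.of_le (by exact_mod_cast hj)
  have hgj : ContDiffAt ℚ j g x := hg.contDiffAt.of_le (by exact_mod_cast hj)
  rw [iteratedDeriv_fun_add hfj hgj]
  exact (hf.ord j hj).add (hg.ord j hj)

/-- Finite sums (same exponent). [folklore] -/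
theorem sum [Fact p.Prime] {ι : Type*} (s : Finset ι) {F : ι → ℚ → ℚ}
    (h : ∀ i ∈ s, IsDOrd p e N (F i) x) : IsDOrd p e N (fun t => ∑ i ∈ s, F i t) x := by
  classical
  induction s using Finset.induction_on with
  | empty =>
    refine ⟨by simpa using contDiffAt_const, fun j _ => ?_⟩
    simp only [sum_empty]
    rcases Nat.eq_zero_or_pos j with rfl | hj
    · simpa using PadicOrdGe.zero (p := p) (e - 0)
    · rw [iteratedDeriv_const]; simp [hj.ne', PadicOrdGe.zero]
  | insert a s ha ih =>
    have := (h a (mem_insert_self a s)).add (ih fun i hi => h i (mem_insert_of_mem hi))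
    simpa [sum_insert ha] using this

/-- A constant `c` with `ord_p c ≥ v`. [folklore] -/
theorem const (N : ℕ) (x : ℚ) {c : ℚ} {v : ℤ} (hc : PadicOrdGe p v c) :
    IsDOrd p v N (fun _ => c) x := by
  refine ⟨contDiffAt_const, fun j _ => ?_⟩
  rcases Nat.eq_zero_or_pos j with rfl | hj
  · simpa using hc
  · rw [iteratedDeriv_const]
    simp [hj.ne', PadicOrdGe.zero]

/-- Multiplication by a constant `c` with `ord_p c ≥ v` shifts the exponent by `v`. [folklore] -/
theorem const_mul [Fact p.Prime] (hf : IsDOrd p e N f x) {c : ℚ} {v : ℤ} (hc : PadicOrdGe p v c) :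
    IsDOrd p (v + e) N (fun t => c * f t) x :=
  (const N x hc).mul hf

/-- `IsDOrd` only depends on the germ of `f` at `x`. [folklore] -/
theorem congr (hf : IsDOrd p e N f x) (hfg : f =ᶠ[nhds x] g) : IsDOrd p e N g x := by
  refine ⟨hf.contDiffAt.congr_of_eventuallyEq hfg.symm, fun j hj => ?_⟩
  rw [← (hfg.iteratedDeriv j).eq_of_nhds]
  exact hf.ord j hj

end IsDOrd

end Literature.NumberTheory.Transcendental
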